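import Summits.QuantumFields.BalabanUV.Beta.EriceRemainderEnclosureHistoryAutonomyComparisonSlackCriterion
import Summits.QuantumFields.BalabanUV.Beta.EriceRemainderEnclosureHistoryAutonomyComparisonLoadBudgetWindow

/-!
# EriceRemainderEnclosureHistoryAutonomyComparisonBudgetedCriterion — (E65b) THE BUDGETED SLACK CRITERION: `B(u) = b + Σ_{k<K} L_k·u_k` (ANY finite age set
# `A ⊆ [1,K[`, sizes and Markov weight ARBITRARY) compares at any size under every isotone excess as soon as a certificate `π ≥ 0` of (E64e)'s slack system
# exists FOR EVERY LOAD VECTOR `x ≥ 0` ON `A` OBEYING THE WINDOW BUDGET OF (E65a) at every scale `j ≥ 1` (and (E58b)'s profile bound) — the socket through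
# which purely finite-dimensional lemmas about loads and certificates settle comparison, trajectories never touched again; first plug: if ONE scale `j`
# has all window weights `W_j(k) ≥ 1∕2` on `A`, the constant certificate `π ≡ 1` works (`le_of_isotone_excess_of_halfweight_scale`)

Cell `pub-balaban`, β-function sub-cell, BINDER row D4 «RemainderConst leaves for Bałaban's split» (`HOME/BINDER-OWNERS.md`; owner lineage `b2b-balaban-beta-an4`;
this file by co-owner #2 lineage `b2b-balaban-beta-d4-p2`, generation 58), β-FLOW TEAM duty (1), FREEZE (0) honoured (def-free; (E64e)'s
`effective_le_of_family_le_at_certificate`, (E65a)'s `load_budget_window` ∕ `readWindow_nonneg`, (E63a)'s `le_of_isotone_excess_of_step_below`, (E58b)'s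
`weight_le_profile`, (E43)'s `affine_monotone` ∕ `affine_floor` ∕ `affine_zerothMoment` BY NAME; nothing restated).

HONEST FRAMING (page 1, verbatim and binding).  *"Discharging BetaPertH makes Bałaban's UV stability UNCONDITIONAL — a real constructive-QFT result; it is
NOT the continuum limit and NOT the Clay problem."*  THIS FILE DISCHARGES NOTHING OF THE KIND.  Elementary real analysis about ABSTRACT affine functionals on a
box ]0,γ]^ℕ with displayed supports and signs — hypotheses of a census, not facts; the form, signs, ages and moments of Bałaban's (1.22) limit functional are
NOT PRINTED ([I] p. 298; GAPS G-t4-U2-1∕-2) and NOT asserted.  Row D4 class UNCHANGED (critical-path width 0; instance 0∕1; D4 DISCHARGE NO DATE).  HONEST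
DEPENDENCY: continuum YM on T⁴ ⇐ BetaPertH ∧ nine spine estimates (0/9 proved); BetaPertH ⇐ (D1) ∧ (D4) ∧ CAP+tail; G-an2-4 gates asym, D1 and NE2/3/4.

THE POINT (census sense (α); the COMPARISON column, conjecture (E58′), route (C)).  (E64e) takes ONE certificate for the profile loads `x̂_j = L_j∕(2P_j)`.  But
the STEP is applied pin by pin, and at each pin the TRUE loads `x_k = k·L_k·h_k³∕2` of the base trajectory obey the window budget of (E65a)
(`Σ_{k≤j} x_k·S_{k,j}∕j + Σ_{k>j} x_k·S_{k,j}∕k ≤ 1∕2` at every `j ≥ 1`, `S_{k,j} = Σ_{l<j} √(k∕(k+l+1))`) and (E58b)'s bound `x_k ≤ x̂_k`; so it suffices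
that a certificate exist for EVERY non-negative load vector obeying these finitely describable constraints — a statement about a polytope and a family of
linear programs, nothing else (§2 `le_of_isotone_excess_budgeted_certificate`).  Numerically (`HOME/…/g58/e65/README.md`: exact simplex, pure python) the
value of (E64e)'s LP over the budget polytope is `≤ 0.868` on every age set tried (all three-age sets over a grid of ratios `1.5 … 100`²; dense, mixed and
random sets of up to eight ages; geometric towers of every ratio `2 … 100` to height `25` with room factor `≥ 1.63`), and the GREEDY youngest-first dual
(`π_k(1 + x_k∕4) = (1 − Σ_{j<k} x_j(k∕(k+j))²π_j)₊`) is within `0.02` of optimal everywhere — the conjectured universal certificate.  §3 is the first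
(trivial) plug: if at ONE scale `j ≥ 1` every age of `A` has window weight `≥ 1∕2`, the budget gives `Σ_{k∈A} x_k ≤ 1` and `π ≡ 1` certifies — e.g. `A ⊆
[2,17]` (`j = 10`), `A ⊆ [14,175]` (`j = 100`): windows of factor `8.5`, `12.5` ((E63e): factor `7` via the profile condition).  NOT CLAIMED: a certificate for
every budgeted load vector (OPEN — it would settle (E58′)); anything printed.

WHAT IS PROVED ([folklore]; 0 `def`, 0 sorry).  §1 **`budget_on_ages`** (the window budget restricted to `A`, in the loads).  §2 **`le_of_isotone_excess_budgeted_certificate`**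
(END).  §3 `certificate_one_of_sum_le_one`, **`le_of_isotone_excess_of_halfweight_scale`**.
-/
noncomputable section
open Finset Set

namespace Summit.QuantumFields.BalabanUV.Beta.EriceRemainderEnclosureHistoryAutonomyComparisonBudgetedCriterion

open Literature.MathematicalPhysics.QuantumFieldTheory.Balaban1983to89
open Literature.MathematicalPhysics.QuantumFieldTheory.Balaban1983to89.T4BetaStationary
open Literature.MathematicalPhysics.QuantumFieldTheory.Balaban1983to89.T4BetaFlowWellPosed
open Summit.QuantumFields.BalabanUV.Beta.EriceRemainderEnclosureHistoryAutonomyComparisonAffineProfile (weight_le_profile)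
open Summit.QuantumFields.BalabanUV.Beta.EriceRemainderEnclosureHistoryAutonomyComparisonDropBound (le_of_isotone_excess_of_step_below)
open Summit.QuantumFields.BalabanUV.Beta.EriceRemainderEnclosureHistoryAutonomyComparisonSlackCriterion (effective_le_of_family_le_at_certificate)
open Summit.QuantumFields.BalabanUV.Beta.EriceRemainderEnclosureHistoryAutonomyComparisonLoadBudgetWindow (load_budget_window readWindow_nonneg)
open Summit.QuantumFields.BalabanUV.Beta.EriceRemainderEnclosureHistoryAutonomyMonotone (affine_monotone affine_floor affine_zerothMoment)

variable {B' : (ℕ → ℝ) → ℝ} {M' γ b y : ℝ} {L : ℕ → ℝ} {K : ℕ} {A : Finset ℕ} {h h' : ℕ → ℝ}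

/-! ## §1 The window budget on the ages, in the loads -/

/-- **THE WINDOW BUDGET ON THE AGES, IN THE LOADS**: along every box solution `h` of `B(u) = b + Σ_{k<K} L_k·u_k` (`b > 0`, `L ≥ 0`) from every pin `y > 0`,
for every finite `A ⊆ [0,K[` and every scale `j ≥ 1`, the loads `x_k = L_k·k·h_k³∕2` satisfy `Σ_{k∈A} x_k·W_j(k) ≤ 1∕2`, `W_j(k) = S_{k,j}∕j` (`k ≤ j`) ∕
`S_{k,j}∕k` (`k > j`), `S_{k,j} = Σ_{l<j} √(k∕(k+l+1))` — (E65a) `load_budget_window` restricted to `A` (non-negative terms). [folklore] -/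
theorem budget_on_ages (hL : ∀ k, 0 ≤ L k) (hb : 0 < b) (hAK : A ⊆ range K) (hy : 0 < y) (hh : SeqBox γ h)
    (hf : MemFlow (fun u : ℕ → ℝ => b + ∑ k ∈ range K, L k * u k) y h) {j : ℕ} (hj : 1 ≤ j) :
    ∑ k ∈ A, L k * k * h k ^ 3 / 2 *
      (if k ≤ j then (∑ l ∈ range j, Real.sqrt ((k : ℝ) / ((k : ℝ) + l + 1))) / j
        else (∑ l ∈ range j, Real.sqrt ((k : ℝ) / ((k : ℝ) + l + 1))) / k) ≤ 1 / 2 := by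
  have hmono := affine_monotone (γ := γ) (b₀ := b) (K := K) hL
  have hlo := affine_floor (γ := γ) (b₀ := b) (K := K) hL
  have hdom : ∀ u, SeqBox γ u → ∑ k ∈ range K, L k * u k ≤ (fun u : ℕ → ℝ => b + ∑ k ∈ range K, L k * u k) u := fun u _ => by
    simp only; linarith
  have hbud := load_budget_window (B := fun u : ℕ → ℝ => b + ∑ k ∈ range K, L k * u k) hmono hL hb hlo hdom hy hh hf hj
  have hnn : ∀ k ∈ range K, 0 ≤ L k * k * h k ^ 3 *
      (if k ≤ j then (∑ l ∈ range j, Real.sqrt ((k : ℝ) / ((k : ℝ) + l + 1))) / j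
        else (∑ l ∈ range j, Real.sqrt ((k : ℝ) / ((k : ℝ) + l + 1))) / k) := by
    intro k _
    have := (hh k).1; have := hL k; have := readWindow_nonneg k j
    split_ifs <;> positivity
  have hsub := sum_le_sum_of_subset_of_nonneg hAK fun k hk _ => hnn k hk
  have e : ∑ k ∈ A, L k * k * h k ^ 3 / 2 *
      (if k ≤ j then (∑ l ∈ range j, Real.sqrt ((k : ℝ) / ((k : ℝ) + l + 1))) / j
        else (∑ l ∈ range j, Real.sqrt ((k : ℝ) / ((k : ℝ) + l + 1))) / k) =
      (1 / 2) * ∑ k ∈ A, L k * k * h k ^ 3 *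
      (if k ≤ j then (∑ l ∈ range j, Real.sqrt ((k : ℝ) / ((k : ℝ) + l + 1))) / j
        else (∑ l ∈ range j, Real.sqrt ((k : ℝ) / ((k : ℝ) + l + 1))) / k) := by
    rw [mul_sum]; exact sum_congr rfl fun k _ => by ring
  rw [e]; linarith

/-! ## §2 END: comparison at any size when every budgeted load vector has a certificate -/

/-- **THE BUDGETED SLACK CRITERION.**  `B(u) = b + Σ_{k<K} L_k·u_k` on ]0,γ] (`b > 0`, `L ≥ 0` supported on `{0} ∪ A`, `A ⊆ [1,K[` ANY finite set of ages;
sizes and Markov weight ARBITRARY).  Suppose that FOR EVERY load vector `x ≥ 0` on `A` which obeys (i) (E58b)'s profile bound `x_k ≤ L_k∕(2P_k)`,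
`P_k = Σ_{k′<K} L_{k′}√(k∕(k+k′))`, and (ii) (E65a)'s WINDOW BUDGET `Σ_{k∈A} x_k·W_j(k) ≤ 1∕2` at EVERY scale `j ≥ 1` (`W_j(k) = S_{k,j}∕j` for `k ≤ j`,
`S_{k,j}∕k` for `k > j`, `S_{k,j} = Σ_{l<j} √(k∕(k+l+1))`), there are weights `π ≥ 0` on `A` with **`π_{k′} + Σ_{j∈A} x_j(k′∕(k′+j))²π_j ≥ 1`** (`k′ ∈ A`) and
**`Σ_{j∈A} x_jπ_j ≤ 1`**.  Then for every `B′ ≥ B` with a zeroth moment and an ISOTONE excess, ANY box solutions from one pin satisfy `h′ ≤ h` at EVERY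
scale.  Proof: (E63a)'s principle; at each pin the TRUE loads `x_k = k·L_k·h_k³∕2` of the base solution obey (i) (`weight_le_profile`) and (ii) (§1), the
hypothesis hands a certificate, and (E64e)'s STEP `effective_le_of_family_le_at_certificate` closes.  So (E58′) for the age set `A` is reduced to a statement
about the budget polytope and a family of linear programs (value `≤ 0.868` on everything computed; README). [folklore] -/
theorem le_of_isotone_excess_budgeted_certificate {p : ℝ} (hL : ∀ k, 0 ≤ L k) (hb : 0 < b) (hAK : A ⊆ range K) (hA1 : ∀ k ∈ A, 1 ≤ k)
    (hsupp : ∀ k ∈ range K, k ∉ A → k ≠ 0 → L k = 0)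
    (hcert : ∀ x : ℕ → ℝ, (∀ k ∈ A, 0 ≤ x k) →
      (∀ k ∈ A, x k ≤ L k / (2 * ∑ k' ∈ range K, L k' * Real.sqrt ((k : ℝ) / ((k : ℝ) + k')))) →
      (∀ j : ℕ, 1 ≤ j → ∑ k ∈ A, x k *
        (if k ≤ j then (∑ l ∈ range j, Real.sqrt ((k : ℝ) / ((k : ℝ) + l + 1))) / j
          else (∑ l ∈ range j, Real.sqrt ((k : ℝ) / ((k : ℝ) + l + 1))) / k) ≤ 1 / 2) →
      ∃ π : ℕ → ℝ, (∀ k ∈ A, 0 ≤ π k) ∧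
        (∀ k' ∈ A, 1 ≤ π k' + ∑ j ∈ A, x j * ((k' : ℝ) / ((k' : ℝ) + j)) ^ 2 * π j) ∧ ∑ j ∈ A, x j * π j ≤ 1)
    (hB' : ∀ u u' : ℕ → ℝ, SeqBox γ u → SeqBox γ u' → ∀ D : ℝ, (∀ j, |u j - u' j| ≤ D) → |B' u - B' u'| ≤ M' * D) (hM' : 0 ≤ M')
    (hexc : ∀ u, SeqBox γ u → (fun u : ℕ → ℝ => b + ∑ k ∈ range K, L k * u k) u ≤ B' u)
    (hDmono : ∀ u v : ℕ → ℝ, SeqBox γ u → SeqBox γ v → (∀ j, u j ≤ v j) →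
      B' u - (fun u : ℕ → ℝ => b + ∑ k ∈ range K, L k * u k) u ≤ B' v - (fun u : ℕ → ℝ => b + ∑ k ∈ range K, L k * u k) v)
    (hp : 0 < p) (hpγ : p ≤ γ) (hh : SeqBox γ h) (hf : MemFlow (fun u : ℕ → ℝ => b + ∑ k ∈ range K, L k * u k) p h)
    (hh' : SeqBox γ h') (hf' : MemFlow B' p h') (j : ℕ) : h' j ≤ h j := by
  have hmono := affine_monotone (γ := γ) (b₀ := b) (K := K) hL
  have hlo := affine_floor (γ := γ) (b₀ := b) (K := K) hL
  have hdom : ∀ u, SeqBox γ u → ∑ k ∈ range K, L k * u k ≤ (fun u : ℕ → ℝ => b + ∑ k ∈ range K, L k * u k) u := fun u _ => by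
    simp only; linarith
  refine le_of_isotone_excess_of_step_below (B := fun u : ℕ → ℝ => b + ∑ k ∈ range K, L k * u k) hmono
    (affine_zerothMoment hL) (sum_nonneg fun k _ => hL k) hb hlo hB' hM' hexc hDmono
    (fun _ _ hS huniq hS' huniq' _ hy _ hdeep u _ hu hfu hu' hfu' hle => ?_) hp hpγ hh hf hh' hf' j
  -- the true loads of the base solution at this pin
  have hx0 : ∀ k ∈ A, 0 ≤ L k * k * u k ^ 3 / 2 := fun k _ => by have := (hu k).1; have := hL k; positivity
  have hxP : ∀ k ∈ A, L k * k * u k ^ 3 / 2 ≤ L k / (2 * ∑ k' ∈ range K, L k' * Real.sqrt ((k : ℝ) / ((k : ℝ) + k'))) := by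
    intro k hkA
    have := weight_le_profile hmono hL hb hlo hdom hy hu hfu (hAK hkA)
    rw [show L k / (2 * ∑ k' ∈ range K, L k' * Real.sqrt ((k : ℝ) / ((k : ℝ) + k'))) =
        L k / (∑ k' ∈ range K, L k' * Real.sqrt ((k : ℝ) / ((k : ℝ) + k'))) / 2 by rw [div_div, mul_comm]]
    linarith
  have hxB : ∀ j : ℕ, 1 ≤ j → ∑ k ∈ A, L k * k * u k ^ 3 / 2 *
      (if k ≤ j then (∑ l ∈ range j, Real.sqrt ((k : ℝ) / ((k : ℝ) + l + 1))) / j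
        else (∑ l ∈ range j, Real.sqrt ((k : ℝ) / ((k : ℝ) + l + 1))) / k) ≤ 1 / 2 :=
    fun j hj => budget_on_ages hL hb hAK hy hu hfu hj
  obtain ⟨π, hπ, hdual, hcost⟩ := hcert (fun k => L k * k * u k ^ 3 / 2) hx0 hxP hxB
  exact effective_le_of_family_le_at_certificate (xh := fun k => L k * k * u k ^ 3 / 2)
    hL hb hAK hA1 hsupp hexc hDmono hS huniq hS' huniq' hy hdeep hu hfu hu' hfu' hle (fun j _ => by ring_nf; rfl) hπ hdual hcost

/-! ## §3 First plug: one scale with all window weights at least one half -/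

/-- The constant certificate: if the loads on `A` sum to at most `1`, then `π ≡ 1` satisfies (E64e)'s dual system for ANY non-negative couplings
(`1 ≤ 1 + Σ_j x_j·G_{k′j}`, `Σ_j x_j·1 ≤ 1`). [folklore] -/
theorem certificate_one_of_sum_le_one {x : ℕ → ℝ} (hx : ∀ k ∈ A, 0 ≤ x k) (hsum : ∑ k ∈ A, x k ≤ 1) :
    ∃ π : ℕ → ℝ, (∀ k ∈ A, 0 ≤ π k) ∧
      (∀ k' ∈ A, 1 ≤ π k' + ∑ j ∈ A, x j * ((k' : ℝ) / ((k' : ℝ) + j)) ^ 2 * π j) ∧ ∑ j ∈ A, x j * π j ≤ 1 := by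
  refine ⟨fun _ => 1, fun _ _ => zero_le_one, fun k' _ => ?_, by simpa using hsum⟩
  have : 0 ≤ ∑ j ∈ A, x j * ((k' : ℝ) / ((k' : ℝ) + j)) ^ 2 * 1 := sum_nonneg fun j hj => by have := hx j hj; positivity
  linarith

/-- **ONE HALF-WEIGHT SCALE SUFFICES.**  `B(u) = b + Σ_{k<K} L_k·u_k` (`b > 0`, `L ≥ 0` supported on `{0} ∪ A`, `A ⊆ [1,K[`, sizes and Markov weight
ARBITRARY).  If at ONE scale `j ≥ 1` every age `k ∈ A` has window weight **`W_j(k) ≥ 1∕2`** (`W_j(k) = S_{k,j}∕j` for `k ≤ j`, `S_{k,j}∕k` for `k > j`,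
`S_{k,j} = Σ_{l<j} √(k∕(k+l+1))` — a finite check on `A` alone), then for every `B′ ≥ B` with a zeroth moment and an ISOTONE excess, ANY box solutions from
one pin satisfy `h′ ≤ h` at EVERY scale: the window budget at `j` gives `Σ_{k∈A} x_k ≤ 1` along every trajectory and the constant certificate closes (§2).
Examples (exact sums): `A ⊆ {1,2,3}` (`j = 2`), `A ⊆ [2,17]` (`j = 10`), `A ⊆ [14,175]` (`j = 100`) — windows of factor `8.5` and `12.5`, beyond (E63e)'s
factor `7`; asymptotically `[j∕7.3, 1.78j]`. [folklore] -/
theorem le_of_isotone_excess_of_halfweight_scale {p : ℝ} (hL : ∀ k, 0 ≤ L k) (hb : 0 < b) (hAK : A ⊆ range K) (hA1 : ∀ k ∈ A, 1 ≤ k)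
    (hsupp : ∀ k ∈ range K, k ∉ A → k ≠ 0 → L k = 0) {j₀ : ℕ} (hj₀ : 1 ≤ j₀)
    (hhalf : ∀ k ∈ A, 1 / 2 ≤ (if k ≤ j₀ then (∑ l ∈ range j₀, Real.sqrt ((k : ℝ) / ((k : ℝ) + l + 1))) / j₀
        else (∑ l ∈ range j₀, Real.sqrt ((k : ℝ) / ((k : ℝ) + l + 1))) / k))
    (hB' : ∀ u u' : ℕ → ℝ, SeqBox γ u → SeqBox γ u' → ∀ D : ℝ, (∀ j, |u j - u' j| ≤ D) → |B' u - B' u'| ≤ M' * D) (hM' : 0 ≤ M')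
    (hexc : ∀ u, SeqBox γ u → (fun u : ℕ → ℝ => b + ∑ k ∈ range K, L k * u k) u ≤ B' u)
    (hDmono : ∀ u v : ℕ → ℝ, SeqBox γ u → SeqBox γ v → (∀ j, u j ≤ v j) →
      B' u - (fun u : ℕ → ℝ => b + ∑ k ∈ range K, L k * u k) u ≤ B' v - (fun u : ℕ → ℝ => b + ∑ k ∈ range K, L k * u k) v)
    (hp : 0 < p) (hpγ : p ≤ γ) (hh : SeqBox γ h) (hf : MemFlow (fun u : ℕ → ℝ => b + ∑ k ∈ range K, L k * u k) p h)
    (hh' : SeqBox γ h') (hf' : MemFlow B' p h') (j : ℕ) : h' j ≤ h j := by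
  refine le_of_isotone_excess_budgeted_certificate hL hb hAK hA1 hsupp (fun x hx _ hbud => ?_) hB' hM' hexc hDmono hp hpγ hh hf hh' hf' j
  apply certificate_one_of_sum_le_one hx
  have hb0 := hbud j₀ hj₀
  have hterm : ∀ k ∈ A, x k * (1 / 2) ≤ x k *
      (if k ≤ j₀ then (∑ l ∈ range j₀, Real.sqrt ((k : ℝ) / ((k : ℝ) + l + 1))) / j₀
        else (∑ l ∈ range j₀, Real.sqrt ((k : ℝ) / ((k : ℝ) + l + 1))) / k) :=
    fun k hk => mul_le_mul_of_nonneg_left (hhalf k hk) (hx k hk)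
  have := (sum_le_sum hterm).trans hb0
  rw [← sum_mul] at this
  linarith

end Summit.QuantumFields.BalabanUV.Beta.EriceRemainderEnclosureHistoryAutonomyComparisonBudgetedCriterion

end
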